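import Summits.CriticalPhenomena.PercolationContinuityZ3.Theorems.PercNearOneGluingNoHeavyLowerTailGluedQ9Row
import Summits.CriticalPhenomena.PercolationContinuityZ3.Theorems.PercNearOneGluingNoHeavyLowerTailKernelTwoPlusStarRegimeIIExchange
import HarnessLib

/-!
# `NoHeavyLowerTail` (stmt-CriticalPhenomena-4575) — regime II of the `2 + (any law)` kernel FULLY ANCHORED: rankings in `K_u` only,
# no per-atom hypothesis (Kozma–Nitzan's Question 9 at three relays supplies every atom)

Support file (lemma factory `prim-lf-3` gen 15; `--supports stmt-CriticalPhenomena-4575`).  No definitions, no named facts, no sorries.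
Memo: `run/shared/lean/prim/prim-lf-3/LF3-BETA-R.md` §18b.

Regime II of the formal face (memo §16a): the port `c` is the `K`-weaker port of the two-port star (`hle`) and at most as connected as the
witness `j` in the mixture `K_u = (1−u)·K + u·K[cd↦1]` (`hcju`).  Gen 11 (`face_regimeII`) needed, IN ADDITION, the ranking of `c` against
`d` and `j` in every glued mixture `K_u/Y` (the anchoring proviso of §16e: the ranking may flip after gluing an atom).  With the tree theorem
`HullPort.kn_question9_three` (Kozma–Nitzan's Question 9 at three relays, glued form, designation in the UNGLUED graph; hp-7 gen 31 on the
coupling seat's set-observer chain) every atom's exchange inequality follows from the `K_u`-rankings alone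
(`exchangeII_of_unglued_ranking`), so the proviso disappears:

* `face_regimeII_anchored` — the formal face `0 ≤ Σ_Y ν(Y)[(1−u) G'(Y) + u G(Y ∪ {c,d})]` from the split rows of `c` and `q`, for EVERY law
  `ν ≥ 0`, under `hle`, `hcju`, `hqj`, `hqmin` only;
* `twoPlusLaw_regimeII_anchored` — the `2 + (law ν)` kernel `F ≥ 0`;
* `kernel_twoPlusStar_regimeII_anchored` — the observer-level theorem: one-layer observer `o` with ports `{p₁, p₂} ∪ Q` (any `|Q|`, product law
  on `Q`), `p₁` the `K`-weaker port and at most as connected as the witness `j` in `K_u`, `q` below `j` and every port of `Q` in `K_u`: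
  the split rows of `p₁`, `p₂`, `q` give Kozma–Nitzan's (41), `μ_W(j ↔ b, o ↔ A) ≤ μ_W(o ↔ b)`.
[cite: KozmaNitzan2024, Question 9 (p. 36), Question 7 (p. 36), Thm. 4–5 and Lemma 5 (pp. 12–14), (9) (pp. 9–10)]
-/

namespace Summit.CriticalPhenomena.PercolationContinuityZ3.Theorems

open MeasureTheory Set ProbabilityTheory
open Literature.Probability.LatticeModels
open Literature.Probability.Percolation

noncomputable section
open Classical

namespace UpsetExchange

variable {n : ℕ}

/-- In `K[cd ↦ 1]` the two endpoints of the sure pair are equally connected to `b`. [folklore] -/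
theorem real_openConn_eq_of_surePair (K : Sym2 (Fin n) → unitInterval) (c d b : Fin n) (hcd : c ≠ d) :
    (prodBernoulli (fun f : Sym2 (Fin n) => if f = s(c, d) then 1 else K f)).real (openConn c b) =
      (prodBernoulli (fun f : Sym2 (Fin n) => if f = s(c, d) then 1 else K f)).real (openConn d b) := by
  set g : Sym2 (Fin n) → unitInterval := fun f => if f = s(c, d) then 1 else K f with hg
  have h0 : (prodBernoulli g).real (openConn c d)ᶜ = 0 :=
    real_not_openConn_eq_zero_of_surePair g c d hcd (by simp only [hg, if_true])
  have h1 : (prodBernoulli g).real (openConn c b) ≤ (prodBernoulli g).real (openConn d b) := by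
    calc (prodBernoulli g).real (openConn c b)
        ≤ (prodBernoulli g).real (openConn d b ∪ (openConn c d)ᶜ) := by
          refine measureReal_mono (fun ω hω => ?_) (measure_ne_top _ _)
          by_cases h : ω ∈ openConn c d
          · exact Or.inl ((h : (openGraph ω).Reachable c d).symm.trans (hω : (openGraph ω).Reachable c b))
          · exact Or.inr h
      _ ≤ (prodBernoulli g).real (openConn d b) + (prodBernoulli g).real (openConn c d)ᶜ := measureReal_union_le _ _
      _ = (prodBernoulli g).real (openConn d b) := by rw [h0, add_zero]
  have h2 : (prodBernoulli g).real (openConn d b) ≤ (prodBernoulli g).real (openConn c b) := by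
    calc (prodBernoulli g).real (openConn d b)
        ≤ (prodBernoulli g).real (openConn c b ∪ (openConn c d)ᶜ) := by
          refine measureReal_mono (fun ω hω => ?_) (measure_ne_top _ _)
          by_cases h : ω ∈ openConn c d
          · exact Or.inl ((h : (openGraph ω).Reachable c d).trans (hω : (openGraph ω).Reachable d b))
          · exact Or.inr h
      _ ≤ (prodBernoulli g).real (openConn c b) + (prodBernoulli g).real (openConn c d)ᶜ := measureReal_union_le _ _
      _ = (prodBernoulli g).real (openConn c b) := by rw [h0, add_zero]
  exact le_antisymm h1 h2

/-- **The formal face in regime II, fully anchored** (no per-atom hypothesis).  See the module docstring.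
[cite: KozmaNitzan2024, Question 9 (p. 36), Question 7 (p. 36), Lemma 5 (p. 13)] -/
theorem face_regimeII_anchored (K : Sym2 (Fin n) → unitInterval) (o c d q j b : Fin n) (Q : Finset (Fin n))
    (ν : Finset (Fin n) → ℝ) (hν : ∀ S ∈ Q.powerset, 0 ≤ ν S) (u : unitInterval)
    (hoQ : o ∉ Q) (hcQ : c ∉ Q) (hdQ : d ∉ Q) (hbQ : b ∉ Q) (hcd : c ≠ d) (hoc : o ≠ c) (hod : o ≠ d) (hjo : j ≠ o) (hbo : b ≠ o)
    (hisoK : ∀ u' : Fin n, u' ≠ o → K s(o, u') = 0)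
    (G : Finset (Fin n) → ℝ)
    (hG : ∀ T : Finset (Fin n), G T =
      (prodBernoulli (fun f : Sym2 (Fin n) => if f ∈ T.image (fun t => s(o, t)) then 1 else K f)).real (openConn o b) -
        (prodBernoulli (fun f : Sym2 (Fin n) => if f ∈ T.image (fun t => s(o, t)) then 1 else K f)).real (openConn j b))
    (hle : (prodBernoulli K).real (openConn c b) ≤ (prodBernoulli K).real (openConn d b))
    (hcb : c ≠ b) (hdb : d ≠ b) (hjb : j ≠ b) (hcj : c ≠ j) (hdj : d ≠ j) (hjQ : j ∉ Q)
    (hcju : (1 - (u : ℝ)) * (prodBernoulli K).real (openConn c b) +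
        (u : ℝ) * (prodBernoulli (fun f : Sym2 (Fin n) => if f = s(c, d) then 1 else K f)).real (openConn c b) ≤
      (1 - (u : ℝ)) * (prodBernoulli K).real (openConn j b) +
        (u : ℝ) * (prodBernoulli (fun f : Sym2 (Fin n) => if f = s(c, d) then 1 else K f)).real (openConn j b))
    (hqj : (1 - (u : ℝ)) * (prodBernoulli K).real (openConn q b) +
        (u : ℝ) * (prodBernoulli (fun f : Sym2 (Fin n) => if f = s(c, d) then 1 else K f)).real (openConn q b) ≤
      (1 - (u : ℝ)) * (prodBernoulli K).real (openConn j b) +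
        (u : ℝ) * (prodBernoulli (fun f : Sym2 (Fin n) => if f = s(c, d) then 1 else K f)).real (openConn j b))
    (hqmin : ∀ y ∈ Q, (1 - (u : ℝ)) * (prodBernoulli K).real (openConn q b) +
        (u : ℝ) * (prodBernoulli (fun f : Sym2 (Fin n) => if f = s(c, d) then 1 else K f)).real (openConn q b) ≤
      (1 - (u : ℝ)) * (prodBernoulli K).real (openConn y b) +
        (u : ℝ) * (prodBernoulli (fun f : Sym2 (Fin n) => if f = s(c, d) then 1 else K f)).real (openConn y b))
    (hrowc : 0 ≤ ∑ S ∈ Q.powerset, ν S *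
      ((1 - (u : ℝ)) * ((prodBernoulli (fun e : Sym2 (Fin n) => if (∀ x ∈ e, x ∈ S) ∧ ¬ e.IsDiag then 1 else K e)).real (openConn c b) -
          (prodBernoulli (fun e : Sym2 (Fin n) => if (∀ x ∈ e, x ∈ S) ∧ ¬ e.IsDiag then 1 else K e)).real (openConn j b)) +
        (u : ℝ) * ((prodBernoulli (fun f : Sym2 (Fin n) => if f = s(c, d) then 1 else
              (if (∀ x ∈ f, x ∈ S) ∧ ¬ f.IsDiag then 1 else K f))).real (openConn c b) -
          (prodBernoulli (fun f : Sym2 (Fin n) => if f = s(c, d) then 1 else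
              (if (∀ x ∈ f, x ∈ S) ∧ ¬ f.IsDiag then 1 else K f))).real (openConn j b))))
    (hrowq : 0 ≤ ∑ S ∈ Q.powerset, ν S *
      ((1 - (u : ℝ)) * ((prodBernoulli (fun e : Sym2 (Fin n) => if (∀ x ∈ e, x ∈ S) ∧ ¬ e.IsDiag then 1 else K e)).real (openConn q b) -
          (prodBernoulli (fun e : Sym2 (Fin n) => if (∀ x ∈ e, x ∈ S) ∧ ¬ e.IsDiag then 1 else K e)).real (openConn j b)) +
        (u : ℝ) * ((prodBernoulli (fun f : Sym2 (Fin n) => if f = s(c, d) then 1 else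
              (if (∀ x ∈ f, x ∈ S) ∧ ¬ f.IsDiag then 1 else K f))).real (openConn q b) -
          (prodBernoulli (fun f : Sym2 (Fin n) => if f = s(c, d) then 1 else
              (if (∀ x ∈ f, x ∈ S) ∧ ¬ f.IsDiag then 1 else K f))).real (openConn j b)))) :
    0 ≤ ∑ Y ∈ Q.powerset, ν Y * ((1 - (u : ℝ)) * (if Y = ∅ then 0 else G Y) + (u : ℝ) * G (insert c (insert d Y))) := by
  have hsure := real_openConn_eq_of_surePair K c d b hcd
  have hu1' : 0 ≤ 1 - (u : ℝ) := sub_nonneg.2 (unitInterval.le_one u)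
  have hcdu : (1 - (u : ℝ)) * (prodBernoulli K).real (openConn c b) +
        (u : ℝ) * (prodBernoulli (fun f : Sym2 (Fin n) => if f = s(c, d) then 1 else K f)).real (openConn c b) ≤
      (1 - (u : ℝ)) * (prodBernoulli K).real (openConn d b) +
        (u : ℝ) * (prodBernoulli (fun f : Sym2 (Fin n) => if f = s(c, d) then 1 else K f)).real (openConn d b) := by
    rw [hsure]
    nlinarith [mul_le_mul_of_nonneg_left hle hu1']
  exact face_regimeII_of_exchange K o c d q j b Q ν hν u hoQ hcQ hdQ hbQ hcd hoc hod hjo hbo hisoK G hG hle hcb hdb hcj hdj hjQ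
    (fun Y hY hYe s₀ hs₀ => Or.inl
      (exchangeII_of_unglued_ranking K Y c d j b s₀ u hs₀ (fun h => hbQ (Finset.mem_powerset.1 hY h))
        (fun h => hcQ (Finset.mem_powerset.1 hY h)) hcb hdb hjb hcd hcj hdj hcdu hcju))
    hqj hqmin hrowc hrowq

/-- **The `2 + (any law)` kernel in regime II, fully anchored.**  See the module docstring.
[cite: KozmaNitzan2024, Question 9 (p. 36), Question 7 (p. 36), Lemma 5 (p. 13)] -/
theorem twoPlusLaw_regimeII_anchored (K : Sym2 (Fin n) → unitInterval) (o c d q j b : Fin n) (Q : Finset (Fin n))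
    (ν : Finset (Fin n) → ℝ) (hν : ∀ S ∈ Q.powerset, 0 ≤ ν S) (u : unitInterval) {h₁ h₂ : ℝ}
    (hh₁ : 0 < h₁) (hh₁' : h₁ ≤ 1) (hh₂ : 0 < h₂) (hh₂' : h₂ ≤ 1) (hprod : h₁ * h₂ = u) (hu1 : (u : ℝ) < 1)
    (hoQ : o ∉ Q) (hcQ : c ∉ Q) (hdQ : d ∉ Q) (hbQ : b ∉ Q) (hcd : c ≠ d) (hoc : o ≠ c) (hod : o ≠ d) (hjo : j ≠ o) (hbo : b ≠ o)
    (hisoK : ∀ u' : Fin n, u' ≠ o → K s(o, u') = 0)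
    (G : Finset (Fin n) → ℝ)
    (hG : ∀ T : Finset (Fin n), G T =
      (prodBernoulli (fun f : Sym2 (Fin n) => if f ∈ T.image (fun t => s(o, t)) then 1 else K f)).real (openConn o b) -
        (prodBernoulli (fun f : Sym2 (Fin n) => if f ∈ T.image (fun t => s(o, t)) then 1 else K f)).real (openConn j b))
    (hle : (prodBernoulli K).real (openConn c b) ≤ (prodBernoulli K).real (openConn d b))
    (hcb : c ≠ b) (hdb : d ≠ b) (hjb : j ≠ b) (hcj : c ≠ j) (hdj : d ≠ j) (hjQ : j ∉ Q)
    (hcju : (1 - (u : ℝ)) * (prodBernoulli K).real (openConn c b) +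
        (u : ℝ) * (prodBernoulli (fun f : Sym2 (Fin n) => if f = s(c, d) then 1 else K f)).real (openConn c b) ≤
      (1 - (u : ℝ)) * (prodBernoulli K).real (openConn j b) +
        (u : ℝ) * (prodBernoulli (fun f : Sym2 (Fin n) => if f = s(c, d) then 1 else K f)).real (openConn j b))
    (hqj : (1 - (u : ℝ)) * (prodBernoulli K).real (openConn q b) +
        (u : ℝ) * (prodBernoulli (fun f : Sym2 (Fin n) => if f = s(c, d) then 1 else K f)).real (openConn q b) ≤
      (1 - (u : ℝ)) * (prodBernoulli K).real (openConn j b) +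
        (u : ℝ) * (prodBernoulli (fun f : Sym2 (Fin n) => if f = s(c, d) then 1 else K f)).real (openConn j b))
    (hqmin : ∀ y ∈ Q, (1 - (u : ℝ)) * (prodBernoulli K).real (openConn q b) +
        (u : ℝ) * (prodBernoulli (fun f : Sym2 (Fin n) => if f = s(c, d) then 1 else K f)).real (openConn q b) ≤
      (1 - (u : ℝ)) * (prodBernoulli K).real (openConn y b) +
        (u : ℝ) * (prodBernoulli (fun f : Sym2 (Fin n) => if f = s(c, d) then 1 else K f)).real (openConn y b))
    (hrowc : 0 ≤ ∑ S ∈ Q.powerset, ν S *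
      ((1 - (u : ℝ)) * ((prodBernoulli (fun e : Sym2 (Fin n) => if (∀ x ∈ e, x ∈ S) ∧ ¬ e.IsDiag then 1 else K e)).real (openConn c b) -
          (prodBernoulli (fun e : Sym2 (Fin n) => if (∀ x ∈ e, x ∈ S) ∧ ¬ e.IsDiag then 1 else K e)).real (openConn j b)) +
        (u : ℝ) * ((prodBernoulli (fun f : Sym2 (Fin n) => if f = s(c, d) then 1 else
              (if (∀ x ∈ f, x ∈ S) ∧ ¬ f.IsDiag then 1 else K f))).real (openConn c b) -
          (prodBernoulli (fun f : Sym2 (Fin n) => if f = s(c, d) then 1 else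
              (if (∀ x ∈ f, x ∈ S) ∧ ¬ f.IsDiag then 1 else K f))).real (openConn j b))))
    (hrowd : 0 ≤ ∑ S ∈ Q.powerset, ν S *
      ((1 - (u : ℝ)) * ((prodBernoulli (fun e : Sym2 (Fin n) => if (∀ x ∈ e, x ∈ S) ∧ ¬ e.IsDiag then 1 else K e)).real (openConn d b) -
          (prodBernoulli (fun e : Sym2 (Fin n) => if (∀ x ∈ e, x ∈ S) ∧ ¬ e.IsDiag then 1 else K e)).real (openConn j b)) +
        (u : ℝ) * ((prodBernoulli (fun f : Sym2 (Fin n) => if f = s(d, c) then 1 else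
              (if (∀ x ∈ f, x ∈ S) ∧ ¬ f.IsDiag then 1 else K f))).real (openConn d b) -
          (prodBernoulli (fun f : Sym2 (Fin n) => if f = s(d, c) then 1 else
              (if (∀ x ∈ f, x ∈ S) ∧ ¬ f.IsDiag then 1 else K f))).real (openConn j b))))
    (hrowq : 0 ≤ ∑ S ∈ Q.powerset, ν S *
      ((1 - (u : ℝ)) * ((prodBernoulli (fun e : Sym2 (Fin n) => if (∀ x ∈ e, x ∈ S) ∧ ¬ e.IsDiag then 1 else K e)).real (openConn q b) -
          (prodBernoulli (fun e : Sym2 (Fin n) => if (∀ x ∈ e, x ∈ S) ∧ ¬ e.IsDiag then 1 else K e)).real (openConn j b)) +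
        (u : ℝ) * ((prodBernoulli (fun f : Sym2 (Fin n) => if f = s(c, d) then 1 else
              (if (∀ x ∈ f, x ∈ S) ∧ ¬ f.IsDiag then 1 else K f))).real (openConn q b) -
          (prodBernoulli (fun f : Sym2 (Fin n) => if f = s(c, d) then 1 else
              (if (∀ x ∈ f, x ∈ S) ∧ ¬ f.IsDiag then 1 else K f))).real (openConn j b)))) :
    0 ≤ ∑ Y ∈ Q.powerset, ν Y *
        ((1 - h₁) * (1 - h₂) * (if Y = ∅ then 0 else G Y) + (1 - h₁) * h₂ * G (insert d Y) +
          h₁ * (1 - h₂) * G (insert c Y) + h₁ * h₂ * G (insert c (insert d Y))) := by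
  have hsure := real_openConn_eq_of_surePair K c d b hcd
  have hu1' : 0 ≤ 1 - (u : ℝ) := sub_nonneg.2 (unitInterval.le_one u)
  have hcdu : (1 - (u : ℝ)) * (prodBernoulli K).real (openConn c b) +
        (u : ℝ) * (prodBernoulli (fun f : Sym2 (Fin n) => if f = s(c, d) then 1 else K f)).real (openConn c b) ≤
      (1 - (u : ℝ)) * (prodBernoulli K).real (openConn d b) +
        (u : ℝ) * (prodBernoulli (fun f : Sym2 (Fin n) => if f = s(c, d) then 1 else K f)).real (openConn d b) := by
    rw [hsure]
    nlinarith [mul_le_mul_of_nonneg_left hle hu1']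
  exact twoPlusLaw_regimeII_of_exchange K o c d q j b Q ν hν u hh₁ hh₁' hh₂ hh₂' hprod hu1 hoQ hcQ hdQ hbQ hcd hoc hod hjo hbo hisoK G hG
    hle hcb hdb hcj hdj hjQ
    (fun Y hY hYe s₀ hs₀ => Or.inl
      (exchangeII_of_unglued_ranking K Y c d j b s₀ u hs₀ (fun h => hbQ (Finset.mem_powerset.1 hY h))
        (fun h => hcQ (Finset.mem_powerset.1 hY h)) hcb hdb hjb hcd hcj hdj hcdu hcju))
    hqj hqmin hrowc hrowd hrowq

/-- **The `2 + star` kernel in regime II, observer level, fully anchored**: Kozma–Nitzan's (41) for a one-layer observer with ports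
`{p₁, p₂} ∪ Q` from the split rows of `p₁`, `p₂`, `q`, under rankings in `K` and `K_u` only.  See the module docstring.
[cite: KozmaNitzan2024, Question 9 (p. 36), Question 7 (p. 36), Thm. 4–5 and Lemma 5 (pp. 12–14)] -/
theorem kernel_twoPlusStar_regimeII_anchored (W : Sym2 (Fin n) → unitInterval) (A Q : Finset (Fin n)) (o p₁ p₂ q j b : Fin n)
    (K : Sym2 (Fin n) → unitInterval) (hK : K = fun e => if o ∈ e then 0 else W e)
    (u : unitInterval) (hu : (u : ℝ) = (W s(o, p₁) : ℝ) * W s(o, p₂))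
    (ν : Finset (Fin n) → ℝ) (hν : ∀ Y : Finset (Fin n), ν Y = (∏ q ∈ Y, (W s(o, q) : ℝ)) * ∏ q ∈ Q \ Y, (1 - (W s(o, q) : ℝ)))
    (G : Finset (Fin n) → ℝ)
    (hG : ∀ T : Finset (Fin n), G T =
      (prodBernoulli (fun f : Sym2 (Fin n) => if f ∈ T.image (fun t => s(o, t)) then 1 else K f)).real (openConn o b) -
        (prodBernoulli (fun f : Sym2 (Fin n) => if f ∈ T.image (fun t => s(o, t)) then 1 else K f)).real (openConn j b))
    (hoA : o ∉ A) (hp₁A : p₁ ∈ A) (hp₂A : p₂ ∈ A) (hQA : Q ⊆ A) (hp₁Q : p₁ ∉ Q) (hp₂Q : p₂ ∉ Q) (hbQ : b ∉ Q) (hp : p₁ ≠ p₂)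
    (hjo : j ≠ o) (hbo : b ≠ o)
    (hiso : ∀ u' : Fin n, u' ≠ o → u' ∉ insert p₁ (insert p₂ Q) → W s(o, u') = 0) (hloop : W s(o, o) = 0)
    (hh₁ : 0 < (W s(o, p₁) : ℝ)) (hh₁' : (W s(o, p₁) : ℝ) < 1) (hh₂ : 0 < (W s(o, p₂) : ℝ)) (hh₂' : (W s(o, p₂) : ℝ) < 1)
    (hle : (prodBernoulli K).real (openConn p₁ b) ≤ (prodBernoulli K).real (openConn p₂ b))
    (hjb : j ≠ b) (hp₁j : p₁ ≠ j) (hp₂j : p₂ ≠ j) (hjQ : j ∉ Q) (hbA : b ∉ A)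
    (hcju : (1 - (u : ℝ)) * (prodBernoulli K).real (openConn p₁ b) +
        (u : ℝ) * (prodBernoulli (fun f : Sym2 (Fin n) => if f = s(p₁, p₂) then 1 else K f)).real (openConn p₁ b) ≤
      (1 - (u : ℝ)) * (prodBernoulli K).real (openConn j b) +
        (u : ℝ) * (prodBernoulli (fun f : Sym2 (Fin n) => if f = s(p₁, p₂) then 1 else K f)).real (openConn j b))
    (hqj : (1 - (u : ℝ)) * (prodBernoulli K).real (openConn q b) +
        (u : ℝ) * (prodBernoulli (fun f : Sym2 (Fin n) => if f = s(p₁, p₂) then 1 else K f)).real (openConn q b) ≤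
      (1 - (u : ℝ)) * (prodBernoulli K).real (openConn j b) +
        (u : ℝ) * (prodBernoulli (fun f : Sym2 (Fin n) => if f = s(p₁, p₂) then 1 else K f)).real (openConn j b))
    (hqmin : ∀ y ∈ Q, (1 - (u : ℝ)) * (prodBernoulli K).real (openConn q b) +
        (u : ℝ) * (prodBernoulli (fun f : Sym2 (Fin n) => if f = s(p₁, p₂) then 1 else K f)).real (openConn q b) ≤
      (1 - (u : ℝ)) * (prodBernoulli K).real (openConn y b) +
        (u : ℝ) * (prodBernoulli (fun f : Sym2 (Fin n) => if f = s(p₁, p₂) then 1 else K f)).real (openConn y b))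
    (hrow₁ : 0 ≤ ∑ S ∈ Q.powerset, ν S *
      ((1 - (u : ℝ)) * ((prodBernoulli (fun e : Sym2 (Fin n) => if (∀ x ∈ e, x ∈ S) ∧ ¬ e.IsDiag then 1 else K e)).real (openConn p₁ b) -
          (prodBernoulli (fun e : Sym2 (Fin n) => if (∀ x ∈ e, x ∈ S) ∧ ¬ e.IsDiag then 1 else K e)).real (openConn j b)) +
        (u : ℝ) * ((prodBernoulli (fun f : Sym2 (Fin n) => if f = s(p₁, p₂) then 1 else
              (if (∀ x ∈ f, x ∈ S) ∧ ¬ f.IsDiag then 1 else K f))).real (openConn p₁ b) -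
          (prodBernoulli (fun f : Sym2 (Fin n) => if f = s(p₁, p₂) then 1 else
              (if (∀ x ∈ f, x ∈ S) ∧ ¬ f.IsDiag then 1 else K f))).real (openConn j b))))
    (hrow₂ : 0 ≤ ∑ S ∈ Q.powerset, ν S *
      ((1 - (u : ℝ)) * ((prodBernoulli (fun e : Sym2 (Fin n) => if (∀ x ∈ e, x ∈ S) ∧ ¬ e.IsDiag then 1 else K e)).real (openConn p₂ b) -
          (prodBernoulli (fun e : Sym2 (Fin n) => if (∀ x ∈ e, x ∈ S) ∧ ¬ e.IsDiag then 1 else K e)).real (openConn j b)) +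
        (u : ℝ) * ((prodBernoulli (fun f : Sym2 (Fin n) => if f = s(p₂, p₁) then 1 else
              (if (∀ x ∈ f, x ∈ S) ∧ ¬ f.IsDiag then 1 else K f))).real (openConn p₂ b) -
          (prodBernoulli (fun f : Sym2 (Fin n) => if f = s(p₂, p₁) then 1 else
              (if (∀ x ∈ f, x ∈ S) ∧ ¬ f.IsDiag then 1 else K f))).real (openConn j b))))
    (hrowq : 0 ≤ ∑ S ∈ Q.powerset, ν S *
      ((1 - (u : ℝ)) * ((prodBernoulli (fun e : Sym2 (Fin n) => if (∀ x ∈ e, x ∈ S) ∧ ¬ e.IsDiag then 1 else K e)).real (openConn q b) -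
          (prodBernoulli (fun e : Sym2 (Fin n) => if (∀ x ∈ e, x ∈ S) ∧ ¬ e.IsDiag then 1 else K e)).real (openConn j b)) +
        (u : ℝ) * ((prodBernoulli (fun f : Sym2 (Fin n) => if f = s(p₁, p₂) then 1 else
              (if (∀ x ∈ f, x ∈ S) ∧ ¬ f.IsDiag then 1 else K f))).real (openConn q b) -
          (prodBernoulli (fun f : Sym2 (Fin n) => if f = s(p₁, p₂) then 1 else
              (if (∀ x ∈ f, x ∈ S) ∧ ¬ f.IsDiag then 1 else K f))).real (openConn j b)))) :
    (prodBernoulli W).real (openConn j b ∩ ⋃ a ∈ A, openConn o a) ≤ (prodBernoulli W).real (openConn o b) := by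
  have hp₁b : p₁ ≠ b := fun h => hbA (h ▸ hp₁A)
  have hp₂b : p₂ ≠ b := fun h => hbA (h ▸ hp₂A)
  have hsure := real_openConn_eq_of_surePair K p₁ p₂ b hp
  have hu1' : 0 ≤ 1 - (u : ℝ) := sub_nonneg.2 (unitInterval.le_one u)
  have hcdu : (1 - (u : ℝ)) * (prodBernoulli K).real (openConn p₁ b) +
        (u : ℝ) * (prodBernoulli (fun f : Sym2 (Fin n) => if f = s(p₁, p₂) then 1 else K f)).real (openConn p₁ b) ≤
      (1 - (u : ℝ)) * (prodBernoulli K).real (openConn p₂ b) +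
        (u : ℝ) * (prodBernoulli (fun f : Sym2 (Fin n) => if f = s(p₁, p₂) then 1 else K f)).real (openConn p₂ b) := by
    rw [hsure]
    nlinarith [mul_le_mul_of_nonneg_left hle hu1']
  exact kernel_twoPlusStar_regimeII_of_exchange W A Q o p₁ p₂ q j b K hK u hu ν hν G hG hoA hp₁A hp₂A hQA hp₁Q hp₂Q hbQ hp hjo hbo
    hiso hloop hh₁ hh₁' hh₂ hh₂' hle hp₁j hp₂j hjQ hbA
    (fun Y hY hYe s₀ hs₀ => Or.inl
      (exchangeII_of_unglued_ranking K Y p₁ p₂ j b s₀ u hs₀ (fun h => hbQ (Finset.mem_powerset.1 hY h))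
        (fun h => hp₁Q (Finset.mem_powerset.1 hY h)) hp₁b hp₂b hjb hp hp₁j hp₂j hcdu hcju))
    hqj hqmin hrow₁ hrow₂ hrowq

end UpsetExchange

end

end Summit.CriticalPhenomena.PercolationContinuityZ3.Theorems
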